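import Literature.Topology.FourManifolds.HomotopySpheresBP
import Literature.Topology.FourManifolds.BoundarySignature
import Literature.Topology.FourManifolds.NullCobordismSignature
import Literature.Topology.FourManifolds.SmoothHomologicalOrientation
import HarnessLib

/-!
# Signatures of s-parallelizable manifolds bounded by homotopy spheres: Kervaire–Milnor §7 (trunk T-4MAN)

Layer 2 of the decomposition of the named fact
`Literature.Topology.FourManifolds.exists_commGroup_homotopySphereClass_isCyclic_seven` (`HCobordism.lean`), under its
conjunct (C) `Literature.Topology.FourManifolds.HomotopySphereClass.isCyclic_bP_four_mul` (`HomotopySpheresBP.lean`;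
Kervaire–Milnor, *Groups of homotopy spheres I*, Ann. of Math. 77 (1963), Cor. 7.6: "`bP₄ₘ`,
`m > 1`, is isomorphic to a subgroup of the cyclic group of order `σₘ`. Hence `bP₄ₘ` is finite
cyclic. The proof is evident [from Thm. 7.5]"). This file vendors the printed ingredients of that
evident proof as named facts on honest notions, and `HomotopySpheresBPProofs.lean` proves (C) from
them:

* `HomotopySphere.signatureSet g m h Σ ⊆ ℤ` — the signatures `σ(M)` of the s-parallelizable
  `4m`-manifolds `M` with `bM = Σ` as **oriented** manifolds (Kervaire–Milnor p. 529 and Thm. 7.5: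
  "`Σ₁` and `Σ₂` … which bound s-parallelizable manifolds `M₁` and `M₂`"; `σ(M)` is the signature
  of the closed model `M ∪ cone(bM)`, footnote pp. 528–529, here
  `HomologicalOrientation.signatureInDim` of an orientation of `Literature.Topology.FourManifolds.ClosedModel`, and "oriented" is
  `Literature.Topology.FourManifolds.IsOrientedBoundary` through a homological orientation of `Σ` compatible with its smooth one,
  `Literature.SmoothOrientation.IsCompatible g`, relative to the generator convention `g`);
* `HomotopySphere.sphereSignatureSubgroup`, `HomotopySphere.sigmaGen g m h = σₘ` — "the collection
  of all `4m`-manifolds `M₀` which are s-parallelizable and are bounded by the `(4m-1)`-sphere.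
  Clearly the corresponding signatures `σ(M₀) ∈ ℤ` form a group under addition. Let `σₘ > 0`
  denote the generator of this group" (p. 529);
* named facts: Lemma 7.4 (`exists_mem_signatureSet_sphere_ne_zero`: some such `M₀` has `σ ≠ 0`,
  so `σₘ ≠ 0`), Thm. 7.5 on classes (`mk_eq_mk_iff_sigmaGen_dvd_sub`: `Σ₁ ~ Σ₂` iff
  `σ(M₁) ≡ σ(M₂) mod σₘ`, `m > 1`), additivity of `σ` over the connected sum along the boundary
  (`add_mem_signatureSet_of_isOrientedConnectedSum`, §2 and the first lines of the proof of
  Thm. 7.5), and the two comparison facts between "bounds a parallelizable manifold" (the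
  definition of `bPₙ₊₁`, §4) and "bounds an oriented s-parallelizable manifold" (§7):
  `nonempty_signatureSet_of_boundsParallelizable` and `boundsParallelizable_of_mem_signatureSet`
  (Lemma 3.4: "A connected manifold with non-vacuous boundary is s-parallelizable if and only if
  it is parallelizable").

## Relation to `NullCobordismSignature.lean` and `HomotopySpheresBPOrder.lean`

The sibling file `NullCobordismSignature.lean` (entry notion for the order `|bP₈| = 28`,
`HomotopySpheresBPOrder.lean`) realises the same capped space `W/∂W` for a null-cobordism as
`NullCobordism.Capped c` with `NullCobordism.collapse` and `NullCobordism.signature c h μ`; these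
are **definitionally** the specialisations to `W = c.W` of `Literature.ClosedModel n c.W`,
`Literature.boundaryCollapse n c.W` and `HomologicalOrientation.signatureInDim` of
`BoundarySignature.lean` (which in addition carries the oriented-boundary relation
`Literature.Topology.FourManifolds.IsOrientedBoundary` needed here): `NullCobordism.capped_eq_closedModel`,
`NullCobordism.collapse_eq_boundaryCollapse`, `NullCobordism.signature_eq_signatureInDim` below
(all `rfl`), so that statements in either language apply to the other.

Universe: homotopy spheres have carriers in `Type` (`Literature.Topology.FourManifolds.HomotopySphere`), so all bounding
manifolds live in `Type` (`NullCobordism.{0}`).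
-/

open scoped Manifold ContDiff Topology
open Set Function

noncomputable section

namespace Literature.Topology.FourManifolds

/-- Local notation: `𝔼 n` is the model Euclidean space `EuclideanSpace ℝ (Fin n)`. -/
local notation "𝔼 " n:arg => EuclideanSpace ℝ (Fin n)

/-- Local notation: `𝕊 n` is the unit sphere in `EuclideanSpace ℝ (Fin (n + 1))`. -/
local notation "𝕊 " n:arg => (Metric.sphere (0 : EuclideanSpace ℝ (Fin (n + 1))) 1)

/-! ### Oriented null-cobordisms -/

namespace NullCobordism

variable {n : ℕ} {M : Type} [TopologicalSpace M] [ChartedSpace (𝔼 n) M]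

/-- The boundary identification `M → W` of a null-cobordism as a continuous map. [folklore] -/
def inclMap (c : NullCobordism n M) : C(M, c.W) :=
  ⟨c.incl, c.continuous_incl⟩

/-- `inclMap` is `incl`. [folklore] -/
@[simp] theorem inclMap_apply (c : NullCobordism n M) (x : M) : c.inclMap x = c.incl x := rfl

/-- **`(M, μ) = bW` as oriented manifolds** for a null-cobordism `c` (`W = c.W`, `M = ∂W` via
`c.incl`), the orientation of `W` being recorded as a homological orientation `μ'` of its closed
model `W ∪ cone(∂W)` (`Literature.ClosedModel n c.W`): `Literature.Topology.FourManifolds.IsOrientedBoundary` along `c.incl`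
(`∂[W, ∂W] = incl_* [M]_μ` and `q_* [W, ∂W] = j_* [Ŵ]_{μ'}`). Kervaire–Milnor 1963, §2 ("`-M`"),
§7 ("`Σ = bM`"); Hatcher 2002, §3.3, p. 253. [cite: KervaireMilnorAnnals1963, §7 (Thm. 7.5: "Σ₁ and Σ₂ … bound s-parallelizable manifolds M₁ and M₂")] -/
def IsOrientedBy (c : NullCobordism n M) (μ : Literature.AlgebraicTopology.SingularHomology.HomologicalOrientation ℤ M n)
    (μ' : Literature.AlgebraicTopology.SingularHomology.HomologicalOrientation ℤ (ClosedModel n c.W) (n + 1)) : Prop :=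
  IsOrientedBoundary n c.inclMap c.incl_mem_boundary μ μ'

/-- Unfolding lemma for `NullCobordism.IsOrientedBy`. [folklore] -/
theorem isOrientedBy_iff (c : NullCobordism n M) (μ : Literature.AlgebraicTopology.SingularHomology.HomologicalOrientation ℤ M n)
    (μ' : Literature.AlgebraicTopology.SingularHomology.HomologicalOrientation ℤ (ClosedModel n c.W) (n + 1)) :
    c.IsOrientedBy μ μ' ↔ IsOrientedBoundary n c.inclMap c.incl_mem_boundary μ μ' := Iff.rfl

/-! ### The two capped models of the tree agree -/

/-- The capped space `W/∂W` of `NullCobordismSignature.lean` **is** the closed model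
`W ∪ cone(∂W)` of `BoundarySignature.lean` for `W = c.W` (both are the one-point compactification
of Mathlib's interior `(𝓡∂ (n + 1)).interior W`), definitionally. [folklore] -/
theorem capped_eq_closedModel (c : NullCobordism n M) : c.Capped = ClosedModel n c.W := rfl

/-- The collapse maps `W → W/∂W` of the two files agree, definitionally. [folklore] -/
theorem collapse_eq_boundaryCollapse (c : NullCobordism n M) (x : c.W) :
    c.collapse x = (boundaryCollapse n c.W x : ClosedModel n c.W) := rfl

/-- Kervaire–Milnor's `σ(W)` in the two languages of the tree agree, definitionally:
`NullCobordism.signature c h μ'` (`NullCobordismSignature.lean`) is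
`HomologicalOrientation.signatureInDim h μ'` of the closed model (`BoundarySignature.lean`), for
`μ'` a homological orientation of `W/∂W = ClosedModel n c.W = c.Capped`. [folklore] -/
theorem signature_eq_signatureInDim (c : NullCobordism n M) {k : ℕ} (h : k + k = n + 1)
    (μ' : Literature.AlgebraicTopology.SingularHomology.HomologicalOrientation ℤ (ClosedModel n c.W) (n + 1)) :
    c.signature h (show Literature.AlgebraicTopology.SingularHomology.HomologicalOrientation ℤ c.Capped (n + 1) from μ') =
      μ'.signatureInDim h := rfl

end NullCobordism

/-! ### `σ(M)` for `M` s-parallelizable bounded by `Σ`, and `σₘ` -/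

namespace HomotopySphere

variable {n : ℕ}

/-- **The signatures of the s-parallelizable manifolds bounded by an oriented homotopy sphere.**
For a generator convention `g` (see `SmoothOrientation.IsCompatible`), `n + 1 = 4m` and a homotopy
`n`-sphere `Σ` (with its smooth orientation), `signatureSet g m h Σ` is the set of integers
`σ(M)` where: `μ` is a homological orientation of `Σ` compatible with its smooth orientation,
`M = c.W` is a compact smooth `4m`-manifold with `bM = Σ` (`c : NullCobordism n Σ`) which is
**s-parallelizable** (`Literature.IsStablyParallelizable (𝓡∂ (n + 1)) M`: `τ ⊕ ε¹` trivial,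
Kervaire–Milnor p. 508), `μ'` is an orientation of `M` (of its closed model) with
`(Σ, μ) = bM` as oriented manifolds (`c.IsOrientedBy μ μ'`), and `σ(M)` is the signature of the
intersection pairing on `H₂ₘ` (footnote pp. 528–529: that of the closed model,
`μ'.signatureInDim`). Kervaire–Milnor 1963, §7, p. 529 and Thm. 7.5 ("homotopy spheres of dimension
`4m - 1` … which bound s-parallelizable manifolds `M₁` and `M₂` … `σ(M₁)`"). [cite: KervaireMilnorAnnals1963, §7, p. 529 and Thm. 7.5, with footnote pp. 528–529] -/
def signatureSet (g : Literature.AlgebraicTopology.SingularHomology.HomologicalOrientation ℤ (𝔼 n) n) (m : ℕ) (h : n + 1 = 4 * m)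
    (S : HomotopySphere n) : Set ℤ :=
  {σ | ∃ (μ : Literature.AlgebraicTopology.SingularHomology.HomologicalOrientation ℤ S.carrier n) (c : NullCobordism n S.carrier)
      (μ' : Literature.AlgebraicTopology.SingularHomology.HomologicalOrientation ℤ (ClosedModel n c.W) (n + 1)),
      SmoothOrientation.IsCompatible g S.orientation μ ∧ IsStablyParallelizable (𝓡∂ (n + 1)) c.W ∧
        c.IsOrientedBy μ μ' ∧ μ'.signatureInDim (show 2 * m + 2 * m = n + 1 by omega) = σ}

/-- Membership in `signatureSet`, unfolded. [folklore] -/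
theorem mem_signatureSet_iff {g : Literature.AlgebraicTopology.SingularHomology.HomologicalOrientation ℤ (𝔼 n) n} {m : ℕ} {h : n + 1 = 4 * m}
    {S : HomotopySphere n} {σ : ℤ} :
    σ ∈ signatureSet g m h S ↔
      ∃ (μ : Literature.AlgebraicTopology.SingularHomology.HomologicalOrientation ℤ S.carrier n) (c : NullCobordism n S.carrier)
        (μ' : Literature.AlgebraicTopology.SingularHomology.HomologicalOrientation ℤ (ClosedModel n c.W) (n + 1)),
        SmoothOrientation.IsCompatible g S.orientation μ ∧
          IsStablyParallelizable (𝓡∂ (n + 1)) c.W ∧ c.IsOrientedBy μ μ' ∧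
            μ'.signatureInDim (show 2 * m + 2 * m = n + 1 by omega) = σ :=
  Iff.rfl

/-- **The signatures of the s-parallelizable `4m`-manifolds bounded by the standard sphere**, as
the subgroup of `ℤ` they generate: Kervaire–Milnor 1963, p. 529, "consider the collection of all
`4m`-manifolds `M₀` which are s-parallelizable and are bounded by the `(4m-1)`-sphere. Clearly the
corresponding signatures `σ(M₀) ∈ ℤ` form a group under addition." All orientations `o` of `𝕊ⁿ`
are allowed (they form the same `Θₙ`-class, `HomotopySphereClass.mk_sphere_eq`, and
`σ(-M₀) = -σ(M₀)`), and the subgroup **generated** is taken, so that the definition does not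
presuppose the quoted "clearly". [cite: KervaireMilnorAnnals1963, §7, p. 529 (definition of σₘ)] -/
def sphereSignatureSubgroup (g : Literature.AlgebraicTopology.SingularHomology.HomologicalOrientation ℤ (𝔼 n) n) (m : ℕ) (h : n + 1 = 4 * m) :
    AddSubgroup ℤ :=
  AddSubgroup.closure (⋃ o : SmoothOrientation (𝓡 n) (𝕊 n), signatureSet g m h ⟨𝕊 n, o, ⟨.refl _⟩⟩)

/-- Signatures of s-parallelizable manifolds bounded by the standard sphere lie in the subgroup
they generate. [folklore] -/
theorem mem_sphereSignatureSubgroup {g : Literature.AlgebraicTopology.SingularHomology.HomologicalOrientation ℤ (𝔼 n) n} {m : ℕ}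
    {h : n + 1 = 4 * m} {o : SmoothOrientation (𝓡 n) (𝕊 n)} {σ : ℤ}
    (hσ : σ ∈ signatureSet g m h ⟨𝕊 n, o, ⟨.refl _⟩⟩) : σ ∈ sphereSignatureSubgroup g m h :=
  AddSubgroup.subset_closure (mem_iUnion.2 ⟨o, hσ⟩)

/-- **Kervaire–Milnor's `σₘ`**: "Let `σₘ > 0` denote the generator of this group" (1963, p. 529),
i.e. the least positive element of `sphereSignatureSubgroup g m h` (which generates it, `ℤ` being
principal), with the junk value `0` if the subgroup is trivial (it is not: Lemma 7.4,
`exists_mem_signatureSet_sphere_ne_zero`). Part II / p. 530: `σₘ / 8 = |bP₄ₘ|`; formula (2),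
p. 531: `σₘ/8 = 2²ᵐ⁻²(2²ᵐ⁻¹ - 1) · numerator(4Bₘ/m)` for `m` odd (e.g. `σ₂ / 8 = 28`). [cite: KervaireMilnorAnnals1963, §7, p. 529 (definition of σₘ), p. 530–531] -/
def sigmaGen (g : Literature.AlgebraicTopology.SingularHomology.HomologicalOrientation ℤ (𝔼 n) n) (m : ℕ) (h : n + 1 = 4 * m) : ℕ :=
  sInf {k : ℕ | 0 < k ∧ (k : ℤ) ∈ sphereSignatureSubgroup g m h}

/-- If some nonzero signature occurs for the standard sphere then `σₘ` is a positive element of the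
signature subgroup (well-ordering of `ℕ`). [folklore] -/
theorem sigmaGen_pos_and_mem {g : Literature.AlgebraicTopology.SingularHomology.HomologicalOrientation ℤ (𝔼 n) n} {m : ℕ} {h : n + 1 = 4 * m}
    {σ : ℤ} (hσ : σ ∈ sphereSignatureSubgroup g m h) (hσ0 : σ ≠ 0) :
    0 < sigmaGen g m h ∧ ((sigmaGen g m h : ℕ) : ℤ) ∈ sphereSignatureSubgroup g m h := by
  have hne : {k : ℕ | 0 < k ∧ (k : ℤ) ∈ sphereSignatureSubgroup g m h}.Nonempty := by
    refine ⟨σ.natAbs, Int.natAbs_pos.2 hσ0, ?_⟩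
    rcases Int.natAbs_eq σ with hs | hs
    · rw [← hs]; exact hσ
    · rw [Int.natCast_natAbs]
      rcases le_or_gt 0 σ with h0 | h0
      · rwa [abs_of_nonneg h0]
      · rw [abs_of_neg h0]; exact neg_mem hσ
  exact Nat.sInf_mem hne

/-- `σₘ ≠ 0` as soon as a nonzero signature occurs for the standard sphere (Lemma 7.4). [folklore] -/
theorem sigmaGen_ne_zero {g : Literature.AlgebraicTopology.SingularHomology.HomologicalOrientation ℤ (𝔼 n) n} {m : ℕ} {h : n + 1 = 4 * m}
    {σ : ℤ} (hσ : σ ∈ sphereSignatureSubgroup g m h) (hσ0 : σ ≠ 0) : sigmaGen g m h ≠ 0 :=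
  (sigmaGen_pos_and_mem hσ hσ0).1.ne'

/-! ### The printed ingredients of Cor. 7.6, as named facts -/

/-- **Kervaire–Milnor Lemma 7.4** (1963, p. 529): "For each `k = 2m` there exists a parallelizable
manifold `M₀` whose boundary `bM₀` is the ordinary `(4m - 1)`-sphere, such that the signature
`σ(M₀)` is non-zero" (from Milnor–Kervaire [18, p. 457]: a closed almost parallelizable
`4m`-manifold with `σ ≠ 0`, minus a disc). Vendored as its consequence for `signatureSet`: for
some orientation `o` of `𝕊ⁿ`, `n + 1 = 4m`, `m ≥ 1`, some nonzero integer is the signature of an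
oriented s-parallelizable manifold bounded by `(𝕊ⁿ, o)` (parallelizable implies s-parallelizable,
`IsParallelizable.isStablyParallelizable`; an oriented `M₀` induces an orientation on `bM₀` and
the corresponding homological orientations, Bredon VI.7, VI.9). Hence `σₘ ≠ 0`
(`sigmaGen_ne_zero`). Not proved here: needs the plumbing / almost-parallelizable manifolds of
[18] and the signature theorem. [cite: KervaireMilnorAnnals1963, Lemma 7.4 (p. 529)] -/
def exists_mem_signatureSet_sphere_ne_zero : Prop :=
  ∀ (n m : ℕ) (h : n + 1 = 4 * m), 1 ≤ m → ∀ g : Literature.AlgebraicTopology.SingularHomology.HomologicalOrientation ℤ (𝔼 n) n,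
    ∃ (o : SmoothOrientation (𝓡 n) (𝕊 n)) (σ : ℤ), σ ∈ signatureSet g m h ⟨𝕊 n, o, ⟨.refl _⟩⟩ ∧ σ ≠ 0

/-- **Kervaire–Milnor Theorem 7.5** (1963, p. 529), on classes: "Let `Σ₁` and `Σ₂` be homotopy
spheres of dimension `4m - 1`, `m > 1`, which bound s-parallelizable manifolds `M₁` and `M₂`
respectively. Then `Σ₁` is h-cobordant to `Σ₂` if and only if `σ(M₁) ≡ σ(M₂) mod σₘ`." Here
`σ(Mᵢ)` ranges over `signatureSet g m h Σᵢ` (oriented bounding, same generator convention `g` on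
both sides) and "h-cobordant" (of oriented homotopy spheres, Kervaire–Milnor's `Θₙ`) is equality in
the tree's `Θₙ = HomotopySphereClass n` (oriented diffeomorphism classes), which agrees with the
h-cobordism quotient for `n = 4m - 1 ≥ 7` by Smale's h-cobordism theorem (Kervaire–Milnor p. 505;
Milnor 1965, Thm. 9.1; `HomotopySphere.isHCobordant_iff_nonempty_diffeomorph_of_five_le`). The
printed proof: boundary connected sum with `M₀` (Lemma 7.4), Lemma 7.3 (a framed `4m`-manifold,
`4m > 4`, bounded by a homology sphere can be surgered to a contractible one iff `σ = 0`; Milnor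
[17]) and `-Σ₁ # Σ₂ ~ S⁴ᵐ⁻¹ ⇒ Σ₁ ~ Σ₂`. Not proved here (surgery, §§5–7). [cite: KervaireMilnorAnnals1963, Thm. 7.5 (pp. 529–530)] [cite: MilnorHCobordism1965, Thm. 9.1] -/
def mk_eq_mk_iff_sigmaGen_dvd_sub : Prop :=
  ∀ (n m : ℕ) (h : n + 1 = 4 * m), 1 < m → ∀ (g : Literature.AlgebraicTopology.SingularHomology.HomologicalOrientation ℤ (𝔼 n) n)
    (S T : HomotopySphere n) (σ τ : ℤ), σ ∈ signatureSet g m h S → τ ∈ signatureSet g m h T →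
      (HomotopySphereClass.mk S = HomotopySphereClass.mk T ↔ (sigmaGen g m h : ℤ) ∣ σ - τ)

/-- **Additivity of `σ` over connected sums** (Kervaire–Milnor 1963, §2, pp. 506–508: the connected
sum along the boundary `(W₁, bW₁) # (W₂, bW₂)` with `b((W₁, bW₁) # (W₂, bW₂)) = bW₁ # bW₂`, for
oriented manifolds; first lines of the proof of Thm. 7.5, p. 529: "Form the connected sum along
the boundary … with boundary `Σ₁ # Σ₂`", whose signature is `σ(M₁) + σ(M₂)` and which is again
s-parallelizable): if `(U, o_U)` is an oriented connected sum of the oriented homotopy spheres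
`Σ₁`, `Σ₂` (`Literature.Topology.FourManifolds.IsOrientedConnectedSum`, the relation behind `HomotopySphereClass.IsMul`) and
`σᵢ ∈ signatureSet g m h Σᵢ`, then `σ₁ + σ₂ ∈ signatureSet g m h U`. Not proved here (boundary
connected sum of oriented s-parallelizable manifolds, Novikov additivity of the signature). [cite: KervaireMilnorAnnals1963, §2 (pp. 506–508, (W₁,bW₁)#(W₂,bW₂)) and proof of Thm. 7.5 (p. 529)] -/
def add_mem_signatureSet_of_isOrientedConnectedSum : Prop :=
  ∀ (n m : ℕ) (h : n + 1 = 4 * m) (g : Literature.AlgebraicTopology.SingularHomology.HomologicalOrientation ℤ (𝔼 n) n) (S T U : HomotopySphere n),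
    IsOrientedConnectedSum S.orientation T.orientation U.orientation →
      ∀ σ ∈ signatureSet g m h S, ∀ τ ∈ signatureSet g m h T, σ + τ ∈ signatureSet g m h U

/-- **A homotopy sphere bounding a parallelizable manifold bounds an oriented s-parallelizable one**
(comparison of the definition of `bPₙ₊₁`, Kervaire–Milnor 1963, §4, with the hypothesis of
Thm. 7.5): if `Σ = bW` with `W` parallelizable then `signatureSet g m h Σ` is nonempty — `W` is
s-parallelizable (`IsParallelizable.isStablyParallelizable`), a parallelizable `W` is orientable
and the component containing `bW = Σ` can be oriented so as to induce on `Σ` the homological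
orientation compatible with the given smooth one (Bredon 1993, VI.7.15 and VI.9; Hatcher 2002,
§3.3, p. 253: `∂[W, ∂W] = [∂W]`), and `σ(W)` is then an element. Not proved here (relative
fundamental classes of oriented manifolds with boundary are absent from the tree). [cite: KervaireMilnorAnnals1963, §4 (definition of bP_{n+1}) and §7 (Thm. 7.5, hypothesis)] [cite: Hatcher2002, §3.3, p. 253 and Thm. 3.43] -/
def nonempty_signatureSet_of_boundsParallelizable : Prop :=
  ∀ (n m : ℕ) (h : n + 1 = 4 * m) (g : Literature.AlgebraicTopology.SingularHomology.HomologicalOrientation ℤ (𝔼 n) n) (S : HomotopySphere n),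
    S.BoundsParallelizable → (signatureSet g m h S).Nonempty

/-- **An s-parallelizable manifold bounded by a homotopy sphere may be taken parallelizable**
(Kervaire–Milnor 1963, Lemma 3.4, p. 509: "A connected manifold with non-vacuous boundary is
s-parallelizable if and only if it is parallelizable", applied to the component of `M` containing
`bM = Σ`, which is again a null-cobordism of `Σ`): if `signatureSet g m h Σ` is nonempty then `Σ`
bounds a parallelizable manifold (`HomotopySphere.BoundsParallelizable`, the definition of
`bPₙ₊₁`, §4). Not proved here (Lemma 3.4 rests on Lemma 3.5, obstruction theory for `k`-plane
bundles over `n`-complexes, `k > n`). [cite: KervaireMilnorAnnals1963, Lemma 3.4 (p. 509), with §4 (definition of bP_{n+1})] -/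
def boundsParallelizable_of_mem_signatureSet : Prop :=
  ∀ (n m : ℕ) (h : n + 1 = 4 * m) (g : Literature.AlgebraicTopology.SingularHomology.HomologicalOrientation ℤ (𝔼 n) n) (S : HomotopySphere n)
    (σ : ℤ), σ ∈ signatureSet g m h S → S.BoundsParallelizable

end HomotopySphere

end Literature.Topology.FourManifolds
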